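import Summits.AtomisticToContinuum.Crystallization.Theses.SpectralChargeLedger
import Summits.AtomisticToContinuum.Crystallization.Theorems.OneMultiplierPricing.Negative.BarlowShellDilation
import Summits.AtomisticToContinuum.Crystallization.Theorems.OneMultiplierPricing.Negative.Virial

/-!
# Refutation of `SpectralChargeLedger.OneMultiplierPricing` (stmt-AtomisticToContinuum-17253)

The rank-2 crux of route `SpectralChargeLedger` prices a `τ`-mismatch of the first coordination
shell LINEARLY in `τ` (`x_i + α Φ_i ≥ κ·τ` for every `τ ∈ (0,1]` at which the `13/10·a₀`-shell of
site `i` is not `τ`-matched to the relaxed hcp/fcc 12-shell), uniformly over all finite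
`δ`-separated configurations. Elastic energy is quadratic in strain, so the statement is false:
the Lennard-Jones ground states and their uniform dilates `(1+s)·x^N` are the witness
(`SpectralChargeLedgerOneMultiplierPricing_refuted`, classification `refuted-misstated`; repaired
statement: quadratic pricing `κ·τ²`).

Ingredients (helper lemmas in `Theorems/OneMultiplierPricing/Negative/{BarlowShellDilation,Virial}.lean`,
all [folklore], from tree facts):

* `norm_le_of_mem_barlowStacking` — shell enumeration: for `a ∈ [47/50, 1]` and
  `|h − a√(2/3)| ≤ a/100`, a non-zero point of a Hägg stacking of norm `< 13/10·a` has norm `a`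
  or `√(a²/3 + h²)`;
* `dilation_defect` — a shell `τ`-matched at scale `1` to a reference set of maximal norm `ρ`
  (attained) is not `τ'`-matched at scale `1+s` to any reference set of norms `≤ ρ` unless
  `τ' ≥ (1+s)(ρ−τ) − ρ`;
* `interactionEnergy_smul`, `att_eq_two_mul_rep` (virial identity of a minimiser),
  `interactionEnergy_dilate_le` — `𝓔((1+s)x) − 𝓔(x) ≤ 36 s² |𝓔(x)|` for a ground state `x`;
* the tree facts `LennardJonesGroundStatesExist_holds`, `LennardJonesMinimalDistance_holds` and
  the proved `crysEnergyLimit_proof` (`𝓔(N)/N → e⋆`).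
-/

namespace Summit.AtomisticToContinuum.Crystallization.Theses.SpectralChargeLedger
/-- **Record of the dropped route item `OneMultiplierPricing`** = stmt-AtomisticToContinuum-17253 (ledger signature verbatim; NOT a route
item): route SpectralChargeLedger (2026-08-17T01:05Z) replaced the refuted `OneMultiplierPricing` (stmt-17253) by stmt-17044 under a new name. The declaration `Summit.AtomisticToContinuum.Crystallization.Theses.SpectralChargeLedger.OneMultiplierPricing`
therefore no longer exists in the route file and this accepted module stopped elaborating (stale olean;
buildfix lane 2026-08-19). Re-created here under its original name so the result keeps building; the
statement of every previously accepted declaration in this file is unchanged. -/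
def OneMultiplierPricing : Prop :=
  ∀ δ : ℝ, 0 < δ → ∃ a₀ h₀ r α κ : ℝ, 47 / 50 ≤ a₀ ∧ a₀ ≤ 1 ∧ |h₀ - a₀ * Real.sqrt (2 / 3)| ≤ a₀ / 100 ∧ 0 < r ∧ 0 ≤ α ∧ 0 < κ ∧ ∀ (N : ℕ) (y : Fin N → EuclideanSpace ℝ (Fin 3)), (∀ i j : Fin N, i ≠ j → δ ≤ dist (y i) (y j)) → ∀ i : Fin N, ∀ τ : ℝ, 0 ≤ τ → τ ≤ 1 → ((0 < τ ∧ (∃ A : EuclideanSpace ℝ (Fin 3) →ₗᵢ[ℝ] EuclideanSpace ℝ (Fin 3), (∃ e : ↥{z : EuclideanSpace ℝ (Fin 3) | z ∈ Set.range y ∧ z ≠ y i ∧ dist z (y i) < 13 / 10 * a₀} ≃ ↥{p : EuclideanSpace ℝ (Fin 3) | p ∈ Literature.MathematicalPhysics.StatisticalMechanics.hcpStacking a₀ h₀ ∧ p ≠ 0 ∧ ‖p‖ < 13 / 10 * a₀}, ∀ t : ↥{z : EuclideanSpace ℝ (Fin 3) | z ∈ Set.range y ∧ z ≠ y i ∧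 dist z (y i) < 13 / 10 * a₀}, dist ((t : EuclideanSpace ℝ (Fin 3)) - y i) (A ((e t : ↥{p : EuclideanSpace ℝ (Fin 3) | p ∈ Literature.MathematicalPhysics.StatisticalMechanics.hcpStacking a₀ h₀ ∧ p ≠ 0 ∧ ‖p‖ < 13 / 10 * a₀}) : EuclideanSpace ℝ (Fin 3))) ≤ τ) ∨ (∃ e : ↥{z : EuclideanSpace ℝ (Fin 3) | z ∈ Set.range y ∧ z ≠ y i ∧ dist z (y i) < 13 / 10 * a₀} ≃ ↥{p : EuclideanSpace ℝ (Fin 3) | p ∈ Literature.MathematicalPhysics.StatisticalMechanics.fccStacking a₀ h₀ ∧ p ≠ 0 ∧ ‖p‖ < 13 / 10 * a₀}, ∀ t : ↥{z : EuclideanSpace ℝ (Fin 3) | z ∈ Set.range y ∧ z ≠ y i ∧ dist z (y i) < 13 / 10 * a₀}, dist ((t : EuclideanSpace ℝ (Fin 3)) - y i) (A ((e t : ↥{p : EuclideanSpace ℝ (Fin 3) | p ∈ Literature.MathematicalPhysics.StatisticalMechanics.fccStacking a₀ h₀ ∧ p ≠ 0 ∧ ‖p‖ < 13 / 10 * a₀})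 : EuclideanSpace ℝ (Fin 3))) ≤ τ))) ∨ κ * τ ≤ (∑ j : Fin N, if dist (y i) (y j) ≤ r then ((1 : ℝ) / 2 * Literature.MathematicalPhysics.StatisticalMechanics.siteEnergy Literature.MathematicalPhysics.StatisticalMechanics.lennardJones y j - (⨅ Q : Literature.MathematicalPhysics.StatisticalMechanics.PeriodicConfiguration 3, Q.energyPerParticle Literature.MathematicalPhysics.StatisticalMechanics.lennardJones)) / ((Finset.univ.filter (fun l : Fin N => dist (y l) (y j) ≤ r)).card : ℝ) else 0) + α * ((1 : ℝ) / 2 * ∑ j : Fin N, ∑ k : Fin N, (if ((i ≠ j ∧ dist (y i) (y j) ≤ 6 / 5 * a₀) ∧ (j ≠ i ∧ dist (y j) (y i) ≤ 6 / 5 * a₀) ∧ (i ≠ k ∧ dist (y i) (y k) ≤ 6 / 5 * a₀) ∧ (k ≠ i ∧ dist (y k) (y i) ≤ 6 / 5 * a₀) ∧ (j ≠ k ∧ dist (y j) (y k) ≤ 6 / 5 * a₀) ∧ (k ≠ j ∧ dist (y k) (y j) ≤ 6 / 5 * a₀)) then (if 2 ≤ (Finset.univ.filter (fun l : Fin N =>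 l ≠ i ∧ dist (y l) (y i) ≤ 6 / 5 * a₀ ∧ l ≠ j ∧ dist (y l) (y j) ≤ 6 / 5 * a₀ ∧ l ≠ k ∧ dist (y l) (y k) ≤ 6 / 5 * a₀)).card then (1 : ℝ) / 3 else 1) else 0) * (‖y j - y k‖ ^ 2 - ‖y i - y j‖ ^ 2)))
end Summit.AtomisticToContinuum.Crystallization.Theses.SpectralChargeLedger


noncomputable section

open scoped BigOperators
open Literature.MathematicalPhysics.StatisticalMechanics
open Summit.AtomisticToContinuum.Crystallization.Theorems.OneMultiplierPricing.Negative.BarlowShellDilation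
open Summit.AtomisticToContinuum.Crystallization.Theorems.OneMultiplierPricing.Negative.Virial

namespace Summit.AtomisticToContinuum.Crystallization.Theorems

/-- Refutes `SpectralChargeLedger.OneMultiplierPricing` [refuted-misstated]: the crux prices a
`τ`-mismatch of the first shell LINEARLY (`x_i + α Φ_i ≥ κ·τ` at every site whose 13/10·a₀-shell
is not `τ`-matched to the relaxed hcp/fcc 12-shell), but elastic energy is QUADRATIC in strain.
Witness: the Lennard-Jones ground states `x^N` themselves (δ-separated, `𝓔(N) − N e⋆ = o(N)` by
the proved `CrysEnergyLimit`) and their uniform dilates `(1+s)·x^N`: by the virial identity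
(stationarity of a minimiser under dilation) `𝓔((1+s)x^N) − 𝓔(N) = |𝓔(N)|·(1 − (1+s)⁻⁶)² ≤
36 s² |𝓔(N)|`, while a site whose shell is `sρ/4`-matched at scale `1` is NOT `sρ/2`-matched at
scale `1+s` (`ρ = max(a₀, √(a₀²/3+h₀²))` = the common maximal norm of the two reference shells,
attained in both — shell enumeration `norm_le_of_mem_barlowStacking`); summing the pricing over
the sites of `x^N` and of `(1+s)x^N` gives `N ≤ #bad₁ + #bad₂ < N/3 + N/6 + 72 s K N/(κρ) < N`
for `s` small against `κ`. The charge `Φ` plays no role (`∑ Φ = 0`, `α` arbitrary).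
Repaired statement C′ (believed consistent with elasticity, and `closes` goes through verbatim
with it since it only uses one fixed `τ`): replace the pricing `κ * τ ≤ x_i + α Φ_i` by the
quadratic `κ * τ ^ 2 ≤ x_i + α Φ_i`; the dilation witness misses C′ (both sides are then
`O(s²)`). [folklore] -/
theorem SpectralChargeLedgerOneMultiplierPricing_refuted :
    ¬ Summit.AtomisticToContinuum.Crystallization.Theses.SpectralChargeLedger.OneMultiplierPricing := by
  intro H
  classical
  obtain ⟨δ, hδ, hsepGS⟩ := LennardJonesMinimalDistance_holds
  obtain ⟨a₀, h₀, r, α, κ, ha, ha', hh, hr, hα, hκ, hprice⟩ := H δ hδ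
  set es : ℝ := (⨅ Q : PeriodicConfiguration 3, Q.energyPerParticle lennardJones) with hes
  have hex := LennardJonesGroundStatesExist_holds
  -- the matching predicate, the canonical coefficient, the charge and the local excess
  set GD : (N : ℕ) → (Fin N → EuclideanSpace ℝ (Fin 3)) → Fin N → ℝ → Prop := fun N y i τ =>
    (∃ A : EuclideanSpace ℝ (Fin 3) →ₗᵢ[ℝ] EuclideanSpace ℝ (Fin 3), (∃ e : ↥{z : EuclideanSpace ℝ (Fin 3) | z ∈ Set.range y ∧ z ≠ y i ∧ dist z (y i) < 13 / 10 * a₀} ≃ ↥{p : EuclideanSpace ℝ (Fin 3) | p ∈ Literature.MathematicalPhysics.StatisticalMechanics.hcpStacking a₀ h₀ ∧ p ≠ 0 ∧ ‖p‖ < 13 / 10 * a₀}, ∀ t : ↥{z : EuclideanSpace ℝ (Fin 3) | z ∈ Set.range y ∧ z ≠ y i ∧ dist z (y i) < 13 / 10 * a₀}, dist ((t : EuclideanSpace ℝ (Fin 3)) - y i) (A ((e t : ↥{p : EuclideanSpace ℝ (Fin 3) | p ∈ Literature.MathematicalPhysics.StatisticalMechanics.hcpStacking a₀ h₀ ∧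 p ≠ 0 ∧ ‖p‖ < 13 / 10 * a₀}) : EuclideanSpace ℝ (Fin 3))) ≤ τ) ∨ (∃ e : ↥{z : EuclideanSpace ℝ (Fin 3) | z ∈ Set.range y ∧ z ≠ y i ∧ dist z (y i) < 13 / 10 * a₀} ≃ ↥{p : EuclideanSpace ℝ (Fin 3) | p ∈ Literature.MathematicalPhysics.StatisticalMechanics.fccStacking a₀ h₀ ∧ p ≠ 0 ∧ ‖p‖ < 13 / 10 * a₀}, ∀ t : ↥{z : EuclideanSpace ℝ (Fin 3) | z ∈ Set.range y ∧ z ≠ y i ∧ dist z (y i) < 13 / 10 * a₀}, dist ((t : EuclideanSpace ℝ (Fin 3)) - y i) (A ((e t : ↥{p : EuclideanSpace ℝ (Fin 3) | p ∈ Literature.MathematicalPhysics.StatisticalMechanics.fccStacking a₀ h₀ ∧ p ≠ 0 ∧ ‖p‖ < 13 / 10 * a₀}) : EuclideanSpace ℝ (Fin 3))) ≤ τ)) with hGD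
  set c : (N : ℕ) → (Fin N → EuclideanSpace ℝ (Fin 3)) → Fin N → Fin N → Fin N → ℝ := fun N y i j k => (if ((i ≠ j ∧ dist (y i) (y j) ≤ 6 / 5 * a₀) ∧ (j ≠ i ∧ dist (y j) (y i) ≤ 6 / 5 * a₀) ∧ (i ≠ k ∧ dist (y i) (y k) ≤ 6 / 5 * a₀) ∧ (k ≠ i ∧ dist (y k) (y i) ≤ 6 / 5 * a₀) ∧ (j ≠ k ∧ dist (y j) (y k) ≤ 6 / 5 * a₀) ∧ (k ≠ j ∧ dist (y k) (y j) ≤ 6 / 5 * a₀)) then (if 2 ≤ (Finset.univ.filter (fun l : Fin N => l ≠ i ∧ dist (y l) (y i) ≤ 6 / 5 * a₀ ∧ l ≠ j ∧ dist (y l) (y j) ≤ 6 / 5 * a₀ ∧ l ≠ k ∧ dist (y l) (y k) ≤ 6 / 5 * a₀)).card then (1 : ℝ) / 3 else 1) else 0) with hc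
  set PHI : (N : ℕ) → (Fin N → EuclideanSpace ℝ (Fin 3)) → Fin N → ℝ := fun N y i => (1 : ℝ) / 2 * ∑ j : Fin N, ∑ k : Fin N, c N y i j k * (‖y j - y k‖ ^ 2 - ‖y i - y j‖ ^ 2) with hPHI
  set XX : (N : ℕ) → (Fin N → EuclideanSpace ℝ (Fin 3)) → Fin N → ℝ := fun N y i => (∑ j : Fin N, if dist (y i) (y j) ≤ r then ((1 : ℝ) / 2 * siteEnergy lennardJones y j - es) / ((Finset.univ.filter (fun l : Fin N => dist (y l) (y j) ≤ r)).card : ℝ) else 0) with hXX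
  -- (1) SUMMED PRICING: for a δ-separated `y` and `0 < τ ≤ 1`, `κ τ · #{¬ τ-good} ≤ 𝓔(y) − N e⋆`
  have hsum : ∀ (N : ℕ) (y : Fin N → EuclideanSpace ℝ (Fin 3)),
      (∀ i j : Fin N, i ≠ j → δ ≤ dist (y i) (y j)) → ∀ τ : ℝ, 0 < τ → τ ≤ 1 →
      κ * τ * ((Finset.univ.filter (fun i : Fin N => ¬ GD N y i τ)).card : ℝ)
        ≤ interactionEnergy lennardJones y - (N : ℝ) * es := by
    intro N y hsep τ hτ hτ1
    set B : Finset (Fin N) := Finset.univ.filter (fun i : Fin N => ¬ GD N y i τ) with hB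
    have hpt : ∀ i : Fin N, (if i ∈ B then κ * τ else 0) ≤ XX N y i + α * PHI N y i := by
      intro i
      by_cases hj : i ∈ B
      · rw [if_pos hj]
        rcases hprice N y hsep i τ hτ.le hτ1 with ⟨-, hg⟩ | hle
        · exact absurd hg (Finset.mem_filter.1 hj).2
        · exact hle
      · rw [if_neg hj]
        rcases hprice N y hsep i 0 le_rfl zero_le_one with ⟨h0, -⟩ | hle
        · exact absurd h0 (lt_irrefl 0)
        · rw [mul_zero] at hle
          exact hle
    have hBle : (B.card : ℝ) * (κ * τ) ≤ ∑ i : Fin N, (XX N y i + α * PHI N y i) := by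
      have hs : ∑ i : Fin N, (if i ∈ B then κ * τ else 0) = (B.card : ℝ) * (κ * τ) := by
        rw [Finset.sum_ite_mem, Finset.univ_inter, Finset.sum_const, nsmul_eq_mul]
      rw [← hs]; exact Finset.sum_le_sum fun i _ => hpt i
    have hsumX : ∑ i : Fin N, XX N y i = ∑ j : Fin N, ((1 : ℝ) / 2 * siteEnergy lennardJones y j - es) := by
      simp only [hXX]
      rw [Finset.sum_comm]
      refine Finset.sum_congr rfl fun j _ => ?_
      rw [← Finset.sum_filter, Finset.sum_const, nsmul_eq_mul]
      have hmem : j ∈ Finset.univ.filter (fun l : Fin N => dist (y l) (y j) ≤ r) := by simp [dist_self, hr.le]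
      exact mul_div_cancel₀ _ (by exact_mod_cast (Finset.card_pos.2 ⟨j, hmem⟩).ne')
    have hsumE : ∑ j : Fin N, ((1 : ℝ) / 2 * siteEnergy lennardJones y j - es) = interactionEnergy lennardJones y - (N : ℝ) * es := by
      rw [Finset.sum_sub_distrib, Finset.sum_const, Finset.card_univ, Fintype.card_fin, nsmul_eq_mul,
        ← Finset.mul_sum, ← two_mul_interactionEnergy]
      ring
    have hcyc : ∀ i j k : Fin N, c N y i j k = c N y j k i := by
      intro i j k
      simp only [hc]
      refine if_congr ⟨fun h => ⟨h.2.2.2.2.1, h.2.2.2.2.2, h.2.1, h.1, h.2.2.2.1, h.2.2.1⟩,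
        fun h => ⟨h.2.2.2.1, h.2.2.1, h.2.2.2.2.2, h.2.2.2.2.1, h.1, h.2.1⟩⟩ (if_congr (Iff.of_eq ?_) rfl rfl) rfl
      congr 2
      exact Finset.filter_congr fun l _ => ⟨fun h => ⟨h.2.2.1, h.2.2.2.1, h.2.2.2.2.1, h.2.2.2.2.2, h.1, h.2.1⟩,
        fun h => ⟨h.2.2.2.2.1, h.2.2.2.2.2, h.1, h.2.1, h.2.2.1, h.2.2.2.1⟩⟩
    have hT : ∑ i : Fin N, ∑ j : Fin N, ∑ k : Fin N, c N y i j k * ‖y j - y k‖ ^ 2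
        = ∑ i : Fin N, ∑ j : Fin N, ∑ k : Fin N, c N y i j k * ‖y i - y j‖ ^ 2 := by
      calc ∑ i : Fin N, ∑ j : Fin N, ∑ k : Fin N, c N y i j k * ‖y j - y k‖ ^ 2
          = ∑ j : Fin N, ∑ i : Fin N, ∑ k : Fin N, c N y i j k * ‖y j - y k‖ ^ 2 := Finset.sum_comm
        _ = ∑ j : Fin N, ∑ k : Fin N, ∑ i : Fin N, c N y i j k * ‖y j - y k‖ ^ 2 :=
            Finset.sum_congr rfl fun j _ => Finset.sum_comm
        _ = ∑ j : Fin N, ∑ k : Fin N, ∑ i : Fin N, c N y j k i * ‖y j - y k‖ ^ 2 :=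
            Finset.sum_congr rfl fun j _ => Finset.sum_congr rfl fun k _ => Finset.sum_congr rfl fun i _ => by
              rw [hcyc i j k]
        _ = ∑ i : Fin N, ∑ j : Fin N, ∑ k : Fin N, c N y i j k * ‖y i - y j‖ ^ 2 := rfl
    have hsumPhi : ∑ i : Fin N, PHI N y i = 0 := by
      simp only [hPHI]
      rw [← Finset.mul_sum]
      simp only [mul_sub, Finset.sum_sub_distrib]
      rw [hT, sub_self]
    have h1' := hBle
    rw [Finset.sum_add_distrib, ← Finset.mul_sum, hsumPhi, mul_zero, add_zero, hsumX, hsumE] at h1'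
    linarith
  -- (2) REFERENCE SHELLS: common maximal norm `ρ`, attained in both, and `ρ ≤ 1.01 a₀`
  have ha0 : 0 < a₀ := by linarith
  set b₀ : ℝ := Real.sqrt (a₀ ^ 2 / 3 + h₀ ^ 2) with hb₀
  set ρ : ℝ := max a₀ b₀ with hρ
  have hρa : a₀ ≤ ρ := le_max_left _ _
  have hρ0 : 0 < ρ := lt_of_lt_of_le ha0 hρa
  have hs23 : Real.sqrt (2 / 3) < 817 / 1000 := by
    rw [show (817 : ℝ) / 1000 = Real.sqrt ((817 / 1000) ^ 2) by rw [Real.sqrt_sq (by norm_num)]]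
    exact Real.sqrt_lt_sqrt (by norm_num) (by norm_num)
  have hs23' : (4 : ℝ) / 5 < Real.sqrt (2 / 3) := by
    rw [show (4 : ℝ) / 5 = Real.sqrt ((4 / 5) ^ 2) by rw [Real.sqrt_sq (by norm_num)]]
    exact Real.sqrt_lt_sqrt (by norm_num) (by norm_num)
  have hhhi : h₀ ≤ 827 / 1000 * a₀ := by
    have h1 := (abs_le.1 hh).2
    have h2 := mul_lt_mul_of_pos_left hs23 ha0
    linarith only [h1, h2]
  have hhlo : 79 / 100 * a₀ ≤ h₀ := by
    have h1 := (abs_le.1 hh).1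
    have h2 := mul_lt_mul_of_pos_left hs23' ha0
    linarith only [h1, h2]
  have hb₀le : b₀ ≤ 101 / 100 * a₀ := by
    rw [hb₀, show (101 : ℝ) / 100 * a₀ = Real.sqrt ((101 / 100 * a₀) ^ 2) by
      rw [Real.sqrt_sq (by positivity)]]
    exact Real.sqrt_le_sqrt (by nlinarith only [hhhi, hhlo, ha0])
  have hρle : ρ ≤ 101 / 100 * a₀ := max_le (by linarith only [ha0]) hb₀le
  -- every point of either reference shell has norm ≤ ρ
  have hF1 : ∀ p : EuclideanSpace ℝ (Fin 3),
      (p ∈ {p : EuclideanSpace ℝ (Fin 3) | p ∈ hcpStacking a₀ h₀ ∧ p ≠ 0 ∧ ‖p‖ < 13 / 10 * a₀} ∨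
       p ∈ {p : EuclideanSpace ℝ (Fin 3) | p ∈ fccStacking a₀ h₀ ∧ p ≠ 0 ∧ ‖p‖ < 13 / 10 * a₀}) →
      ‖p‖ ≤ ρ := by
    rintro p (⟨hp, -, hpn⟩ | ⟨hp, -, hpn⟩)
    · exact norm_le_of_mem_barlowStacking ha hh isHaggSeq_alternating hp hpn
    · exact norm_le_of_mem_barlowStacking ha hh isHaggSeq_const hp hpn
  -- both reference shells contain a point of norm exactly ρ
  have hF2 : ∀ s : ℤ → ℤ, IsHaggSeq s →
      ∃ p ∈ {p : EuclideanSpace ℝ (Fin 3) | p ∈ barlowStacking a₀ h₀ s ∧ p ≠ 0 ∧ ‖p‖ < 13 / 10 * a₀},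
        ‖p‖ = ρ := by
    intro s hs
    rcases le_total b₀ a₀ with hab | hab
    · have hρeq : ρ = a₀ := max_eq_left hab
      refine ⟨barlowPos a₀ h₀ s 0 1 0, ⟨barlowPos_mem 0 1 0, ?_, ?_⟩, ?_⟩
      · intro h0
        have h1 := norm_barlowPos_010 ha0.le h₀ s
        rw [h0, norm_zero] at h1
        linarith only [h1, ha0]
      · rw [norm_barlowPos_010 ha0.le h₀ s]; linarith only [ha0]
      · rw [norm_barlowPos_010 ha0.le h₀ s, hρeq]
    · have hρeq : ρ = b₀ := max_eq_right hab
      refine ⟨barlowPos a₀ h₀ s 1 0 0, ⟨barlowPos_mem 1 0 0, ?_, ?_⟩, ?_⟩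
      · intro h0
        have h1 := norm_barlowPos_100 (a := a₀) (h := h₀) hs
        rw [h0, norm_zero] at h1
        have h2 : b₀ = 0 := by rw [hb₀]; exact h1.symm
        linarith only [h2, hab, ha0]
      · rw [norm_barlowPos_100 hs, ← hb₀]; linarith only [hb₀le, ha0]
      · rw [norm_barlowPos_100 hs, ← hb₀, hρeq]
  -- (3) CONSTANTS
  set K₀ : ℝ := max (1 - es) 1 with hK₀
  have hK₀1 : 1 ≤ K₀ := le_max_right _ _
  have hK₀es : 1 - es ≤ K₀ := le_max_left _ _
  have hK₀0 : 0 < K₀ := by linarith only [hK₀1]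
  set s : ℝ := min (1 / 10) (κ * ρ / (20000 * K₀)) with hsdef
  have hs0 : 0 < s := lt_min (by norm_num) (div_pos (mul_pos hκ hρ0) (by positivity))
  have hs10 : s ≤ 1 / 10 := min_le_left _ _
  have hsK : s * (20000 * K₀) ≤ κ * ρ := by
    have h1 := min_le_right (1 / 10 : ℝ) (κ * ρ / (20000 * K₀))
    rw [← hsdef] at h1
    exact (le_div_iff₀ (by positivity)).1 h1
  set τ₁ : ℝ := s * ρ / 4 with hτ₁
  set τ₂ : ℝ := s * ρ / 2 with hτ₂
  have hτ₁0 : 0 < τ₁ := by positivity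
  have hτ₂0 : 0 < τ₂ := by positivity
  have hρ1 : ρ ≤ 101 / 100 := by linarith only [hρle, ha']
  have hsρ : s * ρ ≤ 1 / 10 * (101 / 100) :=
    mul_le_mul hs10 hρ1 hρ0.le (by norm_num)
  have hτ₁1 : τ₁ ≤ 1 := by rw [hτ₁]; linarith only [hsρ]
  have hτ₂1 : τ₂ ≤ 1 := by rw [hτ₂]; linarith only [hsρ]
  set θ : ℝ := κ * ρ * s / 12 with hθ
  have hθ0 : 0 < θ := by positivity
  -- (4) a large `N`: `𝓔(N) < (e⋆ + θ) N` and `𝓔(N) > (e⋆ − 1) N`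
  have hEL := _root_.Summit.AtomisticToContinuum.Crystallization.Theorems.crysEnergyLimit_proof
  unfold Summit.AtomisticToContinuum.Crystallization.Theses.ExcessDecayLiouville.CrysEnergyLimit at hEL
  have hev1 : ∀ᶠ N : ℕ in Filter.atTop, groundStateEnergy lennardJones 3 N / (N : ℝ) < es + θ :=
    (tendsto_order.1 hEL).2 _ (lt_add_of_pos_right _ hθ0)
  have hev2 : ∀ᶠ N : ℕ in Filter.atTop, es - 1 < groundStateEnergy lennardJones 3 N / (N : ℝ) :=
    (tendsto_order.1 hEL).1 _ (by linarith only)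
  obtain ⟨N, hN1, hN2, hN3⟩ := (hev1.and (hev2.and (Filter.eventually_ge_atTop 1))).exists
  have hNpos : (0 : ℝ) < N := by exact_mod_cast hN3
  have hEup : groundStateEnergy lennardJones 3 N < (es + θ) * N := (div_lt_iff₀ hNpos).1 hN1
  have hElo : (es - 1) * N < groundStateEnergy lennardJones 3 N := (lt_div_iff₀ hNpos).1 hN2
  -- (5) the ground state and its dilate
  obtain ⟨x, hx⟩ := hex N
  have hsep : ∀ i j : Fin N, i ≠ j → δ ≤ dist (x i) (x j) := hsepGS N x hx
  have hs1 : (0 : ℝ) < 1 + s := by linarith only [hs0]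
  have hsep' : ∀ i j : Fin N, i ≠ j →
      δ ≤ dist ((fun l => (1 + s) • x l) i) ((fun l => (1 + s) • x l) j) := by
    intro i j hij
    have h1 := hsep i j hij
    show δ ≤ dist ((1 + s) • x i) ((1 + s) • x j)
    rw [dist_smul₀, Real.norm_eq_abs, abs_of_pos hs1]
    exact h1.trans (le_mul_of_one_le_left dist_nonneg (by linarith only [hs0]))
  -- (6) pricing summed over both configurations
  have hS1 := hsum N x hsep τ₁ hτ₁0 hτ₁1
  have hS2 := hsum N (fun l => (1 + s) • x l) hsep' τ₂ hτ₂0 hτ₂1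
  rw [hx.2] at hS1
  have hdil := interactionEnergy_dilate_le hx hs0.le
  rw [hx.2] at hdil
  set B₁ := Finset.univ.filter (fun i : Fin N => ¬ GD N x i τ₁) with hB₁
  set B₂ := Finset.univ.filter (fun i : Fin N => ¬ GD N (fun l => (1 + s) • x l) i τ₂) with hB₂
  have hb1 : κ * τ₁ * (B₁.card : ℝ) < θ * N := by linarith only [hS1, hEup]
  have hb2 : κ * τ₂ * (B₂.card : ℝ) < θ * N + 36 * s ^ 2 * (K₀ * N) := by
    have hEK : -groundStateEnergy lennardJones 3 N ≤ K₀ * N := by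
      have h1 := mul_le_mul_of_nonneg_right hK₀es hNpos.le
      linarith only [h1, hElo]
    have h36 : 36 * s ^ 2 * (-groundStateEnergy lennardJones 3 N) ≤ 36 * s ^ 2 * (K₀ * N) :=
      mul_le_mul_of_nonneg_left hEK (by positivity)
    linarith only [hS2, hdil, h36, hEup]
  -- (7) a τ₁-good site of `x` is τ₂-bad in the dilate
  have hfit : (1 + s) * (ρ + τ₁) < 13 / 10 * a₀ := by
    have h1 : (1 + s) * (1 + s / 4) ≤ 11275 / 10000 := by nlinarith only [hs10, hs0]
    have h2 : (1 + s) * (ρ + τ₁) = ρ * ((1 + s) * (1 + s / 4)) := by rw [hτ₁]; ring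
    rw [h2]
    have h3 := mul_le_mul_of_nonneg_left h1 hρ0.le
    linarith only [h3, hρle, ha0]
  have hkey : ∀ i : Fin N, GD N x i τ₁ → ¬ GD N (fun l => (1 + s) • x l) i τ₂ := by
    intro i hg hg'
    have hdef : (1 + s) * (ρ - τ₁) - ρ ≤ τ₂ := by
      obtain ⟨A, ⟨e, he⟩ | ⟨e, he⟩⟩ := hg <;> obtain ⟨A', ⟨e', he'⟩ | ⟨e', he'⟩⟩ := hg'
      · exact dilation_defect x i _ _ (hF2 _ isHaggSeq_alternating) (fun p hp => hF1 p (Or.inl hp))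
          hs0.le hfit A e he A' e' he'
      · exact dilation_defect x i _ _ (hF2 _ isHaggSeq_alternating) (fun p hp => hF1 p (Or.inr hp))
          hs0.le hfit A e he A' e' he'
      · exact dilation_defect x i _ _ (hF2 _ isHaggSeq_const) (fun p hp => hF1 p (Or.inl hp))
          hs0.le hfit A e he A' e' he'
      · exact dilation_defect x i _ _ (hF2 _ isHaggSeq_const) (fun p hp => hF1 p (Or.inr hp))
          hs0.le hfit A e he A' e' he'
    have hid : (1 + s) * (ρ - τ₁) - ρ - τ₂ = s * ρ * (1 - s) / 4 := by rw [hτ₁, hτ₂]; ring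
    have hpos : 0 < s * ρ * (1 - s) / 4 := by
      have : 0 < 1 - s := by linarith only [hs10]
      positivity
    linarith only [hdef, hid, hpos]
  -- (8) counting: every site is τ₁-bad in `x` or τ₂-bad in the dilate
  have hcover : (Finset.univ : Finset (Fin N)) ⊆ B₁ ∪ B₂ := by
    intro i _
    rw [Finset.mem_union, hB₁, hB₂, Finset.mem_filter, Finset.mem_filter]
    by_cases hg : GD N x i τ₁
    · exact Or.inr ⟨Finset.mem_univ _, hkey i hg⟩
    · exact Or.inl ⟨Finset.mem_univ _, hg⟩
  have hcount : (N : ℝ) ≤ (B₁.card : ℝ) + (B₂.card : ℝ) := by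
    have h1 := (Finset.card_le_card hcover).trans (Finset.card_union_le _ _)
    rw [Finset.card_univ, Fintype.card_fin] at h1
    exact_mod_cast h1
  -- the arithmetic, in the products `P·N`, `P·#B₁`, `P·#B₂` with `P = κ ρ s > 0`:
  -- `P #B₁ < P N/3`, `P #B₂ < P N/6 + 0.0036 P N`, `P N ≤ P #B₁ + P #B₂`
  have hkρs : 0 < κ * ρ * s := by positivity
  have hPN : 0 < κ * ρ * s * N := mul_pos hkρs hNpos
  have hP36 : 36 * s ^ 2 * (K₀ * N) ≤ κ * ρ * s * N * (36 / 20000) := by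
    have h1 := mul_le_mul_of_nonneg_left hsK (by positivity : (0 : ℝ) ≤ 36 * s * N)
    have h2 : 36 * s ^ 2 * (K₀ * N) = 36 * s * N * (s * (20000 * K₀)) / 20000 := by ring
    have h3 : κ * ρ * s * N * (36 / 20000) = 36 * s * N * (κ * ρ) / 20000 := by ring
    rw [h2, h3]
    exact div_le_div_of_nonneg_right h1 (by norm_num)
  have hcount' := mul_le_mul_of_nonneg_left hcount hkρs.le
  rw [hτ₁, hθ] at hb1
  rw [hτ₂, hθ] at hb2
  have e1 : κ * (s * ρ / 4) * (B₁.card : ℝ) = κ * ρ * s * B₁.card / 4 := by ring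
  have e2 : κ * (s * ρ / 2) * (B₂.card : ℝ) = κ * ρ * s * B₂.card / 2 := by ring
  have e3 : κ * ρ * s / 12 * (N : ℝ) = κ * ρ * s * N / 12 := by ring
  have e4 : κ * ρ * s * ((B₁.card : ℝ) + (B₂.card : ℝ)) = κ * ρ * s * B₁.card + κ * ρ * s * B₂.card := by
    ring
  rw [e1, e3] at hb1
  rw [e2, e3] at hb2
  rw [e4] at hcount'
  linarith only [hb1, hb2, hP36, hcount', hPN]


end Summit.AtomisticToContinuum.Crystallization.Theorems

end
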